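import Summits.ValiantsHypothesis.ValiantsHypothesis.Theorems.HartogsRankTwoRobustSparsity

/-!
# ValiantsHypothesis / HartogsRankTwo — item `FactorSideEasy` (stmt-ValiantsHypothesis-10335), part 1

Barvinok's rank-two permanent identity, as a polynomial identity in `ℂ[U, V]`
(`U_{(r,t)} = X (inl (r,t))`, `V_{(i,t)} = X (inr (i,t))`, `t ∈ {0,1}`):
`per_n(U Vᵀ) = Σ_σ Π_i (U_{σ i,0} V_{i,0} + U_{σ i,1} V_{i,1}) = Σ_{k ≤ n} N_{n,k} · E_k(V) · E_k(U)`
with `E_k(V) = Σ_{|S| = k} Π_{i ∈ S} V_{i,0} Π_{i ∉ S} V_{i,1}` (`layerSum`) and `N_{n,k}` the number of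
permutations mapping a fixed `k`-set onto a fixed `k`-set (`refCount`; it is `k!(n-k)!`, which is not
needed). Proof: expand the product over `i` (`Finset.prod_add`), reindex the `U`-part by `σ`, group the
permutations by the image `σ(S)` (`Finset.sum_fiberwise_of_maps_to`), and use that the fibre sizes depend
only on `|S|` (two-sided translation, `nPerm_eq_of_card_eq`). Part 2 bounds the complexity of the
right-hand side. HONEST FRAMING: bookkeeping for a support item; nothing here bears on `VP ≠ VNP`.
-/

-- layout Summits/ValiantsHypothesis/ValiantsHypothesis forces the duplicated namespace component
set_option linter.dupNamespace false

noncomputable section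

namespace Summit.ValiantsHypothesis.ValiantsHypothesis.Theorems.HartogsRankTwo

open MvPolynomial

variable {n : ℕ}

/-- The variables `U_{(r,t)}` (`inl`) and `V_{(i,t)}` (`inr`) of `per_n(U Vᵀ)`. [folklore] -/
abbrev FSVars (n : ℕ) : Type := (Fin n × Fin 2) ⊕ (Fin n × Fin 2)

/-- The mixed monomial `Π_{i ∈ S} Y_{(i,0)} Π_{i ∉ S} Y_{(i,1)}` of a block of variables `Y = X ∘ ι`.
[folklore] -/
def mixedMono (ι : Fin n × Fin 2 → FSVars n) (S : Finset (Fin n)) : MvPolynomial (FSVars n) ℂ :=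
  (∏ i ∈ S, X (ι (i, 0))) * ∏ i ∈ Finset.univ \ S, X (ι (i, 1))

/-- The layer sum `E_k(Y) = Σ_{|S| = k} Π_{i ∈ S} Y_{(i,0)} Π_{i ∉ S} Y_{(i,1)}` (the coefficient of `s^k`
in `Π_i (s Y_{(i,0)} + Y_{(i,1)})`). [folklore] -/
def layerSum (ι : Fin n × Fin 2 → FSVars n) (k : ℕ) : MvPolynomial (FSVars n) ℂ :=
  ∑ S ∈ Finset.powersetCard k (Finset.univ : Finset (Fin n)), mixedMono ι S

/-- The number of permutations of `Fin n` mapping `S` onto `T`. [folklore] -/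
def nPerm (S T : Finset (Fin n)) : ℕ :=
  (Finset.univ.filter fun σ : Equiv.Perm (Fin n) => S.map σ.toEmbedding = T).card

/-- Images of complements under a permutation. [folklore] -/
theorem map_univ_sdiff' (σ : Equiv.Perm (Fin n)) (S : Finset (Fin n)) :
    (Finset.univ \ S).map σ.toEmbedding = Finset.univ \ S.map σ.toEmbedding := by
  ext r
  simp only [Finset.mem_map_equiv, Finset.mem_sdiff, Finset.mem_univ, true_and]

/-- `S.map (τ σ) = (S.map σ).map τ`. [folklore] -/
theorem map_mul_perm (S : Finset (Fin n)) (τ σ : Equiv.Perm (Fin n)) :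
    S.map (τ * σ).toEmbedding = (S.map σ.toEmbedding).map τ.toEmbedding := by
  ext x
  simp only [Finset.mem_map_equiv, Equiv.Perm.mul_def, Equiv.symm_trans_apply]

/-- Left translation: `nPerm S (τ T) = nPerm S T`. [folklore] -/
theorem nPerm_map_right (S T : Finset (Fin n)) (τ : Equiv.Perm (Fin n)) :
    nPerm S (T.map τ.toEmbedding) = nPerm S T := by
  unfold nPerm
  symm
  refine Finset.card_bij' (fun σ _ => τ * σ) (fun σ _ => τ⁻¹ * σ) ?_ ?_ ?_ ?_
  · intro σ hσ
    rw [Finset.mem_filter] at hσ ⊢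
    refine ⟨Finset.mem_univ _, ?_⟩
    rw [map_mul_perm, hσ.2]
  · intro σ hσ
    rw [Finset.mem_filter] at hσ ⊢
    refine ⟨Finset.mem_univ _, ?_⟩
    rw [map_mul_perm, hσ.2, ← map_mul_perm, inv_mul_cancel]
    ext x
    simp only [Finset.mem_map_equiv]
    exact Iff.rfl
  · intro σ _
    rw [← mul_assoc, inv_mul_cancel, one_mul]
  · intro σ _
    rw [← mul_assoc, mul_inv_cancel, one_mul]

/-- Right translation: `nPerm (ρ S) T = nPerm S T`. [folklore] -/
theorem nPerm_map_left (S T : Finset (Fin n)) (ρ : Equiv.Perm (Fin n)) :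
    nPerm (S.map ρ.toEmbedding) T = nPerm S T := by
  unfold nPerm
  refine Finset.card_bij' (fun σ _ => σ * ρ) (fun σ _ => σ * ρ⁻¹) ?_ ?_ ?_ ?_
  · intro σ hσ
    rw [Finset.mem_filter] at hσ ⊢
    refine ⟨Finset.mem_univ _, ?_⟩
    rw [map_mul_perm, hσ.2]
  · intro σ hσ
    rw [Finset.mem_filter] at hσ ⊢
    refine ⟨Finset.mem_univ _, ?_⟩
    rw [← map_mul_perm, mul_assoc, inv_mul_cancel, mul_one, hσ.2]
  · intro σ _
    rw [mul_assoc, mul_inv_cancel, mul_one]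
  · intro σ _
    rw [mul_assoc, inv_mul_cancel, mul_one]

/-- The fibre sizes depend only on the cardinalities: `nPerm S T = nPerm S' T'` when
`|S| = |S'|`, `|T| = |T'|`. [folklore] -/
theorem nPerm_eq_of_card_eq {S S' T T' : Finset (Fin n)} (hS : S.card = S'.card) (hT : T.card = T'.card) :
    nPerm S T = nPerm S' T' := by
  obtain ⟨ρ, hρ⟩ := exists_perm_map_eq S S' hS
  obtain ⟨τ, hτ⟩ := exists_perm_map_eq T T' hT
  rw [← hρ, ← hτ, nPerm_map_left, nPerm_map_right]

/-- The reference count `N_{n,k}`: the number of permutations mapping a `k`-subset of `Fin n` onto a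
`k`-subset (`0` if there is none). [folklore] -/
def refCount (n k : ℕ) : ℕ :=
  if h : ∃ S : Finset (Fin n), S.card = k then nPerm (Classical.choose h) (Classical.choose h) else 0

/-- `nPerm S T = N_{n,k}` whenever `|S| = |T| = k`. [folklore] -/
theorem nPerm_eq_refCount {S T : Finset (Fin n)} {k : ℕ} (hS : S.card = k) (hT : T.card = k) :
    nPerm S T = refCount n k := by
  have h : ∃ S : Finset (Fin n), S.card = k := ⟨S, hS⟩
  rw [refCount, dif_pos h]
  exact nPerm_eq_of_card_eq (hS.trans (Classical.choose_spec h).symm)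
    (hT.trans (Classical.choose_spec h).symm)

/-- **Expansion of one summand.** `Π_i (U_{σ i,0} V_{i,0} + U_{σ i,1} V_{i,1}) =
Σ_S (Π_{i∈S} V_{i,0} Π_{i∉S} V_{i,1}) · (Π_{r∈σ(S)} U_{r,0} Π_{r∉σ(S)} U_{r,1})`. [folklore] -/
theorem prod_rankTwo_eq_sum (σ : Equiv.Perm (Fin n)) :
    (∏ i : Fin n, (X (Sum.inl (σ i, 0)) * X (Sum.inr (i, 0)) + X (Sum.inl (σ i, 1)) * X (Sum.inr (i, 1)) :
        MvPolynomial (FSVars n) ℂ)) =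
      ∑ S ∈ (Finset.univ : Finset (Fin n)).powerset,
        mixedMono Sum.inr S * mixedMono Sum.inl (S.map σ.toEmbedding) := by
  rw [Finset.prod_add]
  refine Finset.sum_congr rfl fun S _ => ?_
  rw [mixedMono, mixedMono, Finset.prod_mul_distrib, Finset.prod_mul_distrib, ← map_univ_sdiff',
    Finset.prod_map, Finset.prod_map]
  simp only [Equiv.coe_toEmbedding]
  ring

/-- **Grouping by the image.** `Σ_σ Π_{r∈σ(S)} U_{r,0} Π_{r∉σ(S)} U_{r,1} = N_{n,|S|} · E_{|S|}(U)`.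
[folklore] -/
theorem sum_perm_mixedMono_map (S : Finset (Fin n)) :
    ∑ σ : Equiv.Perm (Fin n), mixedMono Sum.inl (S.map σ.toEmbedding) =
      (refCount n S.card : ℂ) • layerSum (n := n) Sum.inl S.card := by
  classical
  rw [← Finset.sum_fiberwise_of_maps_to (s := Finset.univ)
    (t := Finset.powersetCard S.card (Finset.univ : Finset (Fin n)))
    (g := fun σ : Equiv.Perm (Fin n) => S.map σ.toEmbedding)
    (fun σ _ => Finset.mem_powersetCard.2 ⟨Finset.subset_univ _, Finset.card_map _⟩)]
  rw [layerSum, Finset.smul_sum]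
  refine Finset.sum_congr rfl fun T hT => ?_
  rw [Finset.mem_powersetCard] at hT
  have hin : ∀ σ ∈ Finset.univ.filter (fun σ : Equiv.Perm (Fin n) => S.map σ.toEmbedding = T),
      mixedMono (n := n) Sum.inl (S.map σ.toEmbedding) = mixedMono Sum.inl T := by
    intro σ hσ
    rw [(Finset.mem_filter.1 hσ).2]
  rw [Finset.sum_congr rfl hin, Finset.sum_const, ← nPerm, nPerm_eq_refCount rfl hT.2, Nat.cast_smul_eq_nsmul]

/-- **`per_n(U Vᵀ)` as a polynomial in `U, V`.** [folklore] -/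
theorem bind₁_perPoly_rankTwo (n : ℕ) :
    bind₁ (fun ij : Fin n × Fin n => ∑ t : Fin 2,
        (X (Sum.inl (ij.1, t)) * X (Sum.inr (ij.2, t)) : MvPolynomial (FSVars n) ℂ))
      (Literature.Computability.AlgebraicComplexity.perPoly (Fin n) ℂ) =
      ∑ σ : Equiv.Perm (Fin n), ∏ i : Fin n,
        (X (Sum.inl (σ i, 0)) * X (Sum.inr (i, 0)) + X (Sum.inl (σ i, 1)) * X (Sum.inr (i, 1))) := by
  rw [Literature.Computability.AlgebraicComplexity.perPoly, Matrix.permanent]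
  simp only [Matrix.mvPolynomialX_apply, map_sum, map_prod, bind₁_X_right, Fin.sum_univ_two]

/-- **Barvinok's rank-two permanent identity.**
`per_n(U Vᵀ) = Σ_{k ≤ n} N_{n,k} · E_k(V) · E_k(U)`. [folklore] -/
theorem bind₁_perPoly_rankTwo_eq_sum_layers (n : ℕ) :
    bind₁ (fun ij : Fin n × Fin n => ∑ t : Fin 2,
        (X (Sum.inl (ij.1, t)) * X (Sum.inr (ij.2, t)) : MvPolynomial (FSVars n) ℂ))
      (Literature.Computability.AlgebraicComplexity.perPoly (Fin n) ℂ) =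
      ∑ k ∈ Finset.range (n + 1),
        (refCount n k : ℂ) • (layerSum (n := n) Sum.inr k * layerSum (n := n) Sum.inl k) := by
  classical
  rw [bind₁_perPoly_rankTwo]
  simp_rw [prod_rankTwo_eq_sum]
  rw [Finset.sum_comm]
  simp_rw [← Finset.mul_sum, sum_perm_mixedMono_map]
  -- group the subsets `S` by their cardinality
  rw [Finset.powerset_card_disjiUnion, Finset.sum_disjiUnion, Finset.card_univ, Fintype.card_fin]
  refine Finset.sum_congr rfl fun k _ => ?_
  have hin : ∀ S ∈ Finset.powersetCard k (Finset.univ : Finset (Fin n)),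
      mixedMono (n := n) Sum.inr S * ((refCount n S.card : ℂ) • layerSum (n := n) Sum.inl S.card) =
      (refCount n k : ℂ) • (mixedMono (n := n) Sum.inr S * layerSum (n := n) Sum.inl k) := by
    intro S hS
    rw [(Finset.mem_powersetCard.1 hS).2, mul_smul_comm]
  rw [Finset.sum_congr rfl hin, ← Finset.smul_sum, ← Finset.sum_mul]
  rfl

end Summit.ValiantsHypothesis.ValiantsHypothesis.Theorems.HartogsRankTwo

end
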